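import Summits.AtomisticToContinuum.HydrodynamicLimit.Theorems.EquilibriumClampedCollisionalWindowLD.Negative.PulseHitTime

/-!
# Newton-cradle pulse, part 2: one transfer (helper file, refutation of `EquilibriumClampedCollisionalWindowLD`, stmt-AtomisticToContinuum-13733, layer L3; see `Cruxes/EquilibriumClampedCollisionalWindowLD/Disproof.lean`, evidence WITNESS.md §4.3; no Theses declaration is asserted; refuter-cdisprove-stmt-AtomisticToContinuum-13733-0)

`transfer_geometry` (the contact normal deviates from the axis by at most `((s-ε)α + 2δ + p²/ε)/ε`: CONTRACTION of direction errors by the factor gap/diameter) and `transfer_kinematics` (elastic exchange of equal masses).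
-/

noncomputable section

open Real
open scoped InnerProductSpace

namespace Summit.AtomisticToContinuum.HydrodynamicLimit.Theorems

namespace EquilibriumClampedCollisionalWindowLDNegative

/-! ## One transfer: geometry of the contact and kinematics of the elastic exchange -/

section Transfer

variable {E : Type*} [NormedAddCommGroup E] [InnerProductSpace ℝ E]

/-- Unit-vector perturbation: normalising `c n + η` (`‖n‖ = 1`, `‖η‖ < c`) moves the direction by at
most `2‖η‖/(c - ‖η‖)`. [folklore] -/
theorem norm_normalize_sub_le {n η : E} (hn : ‖n‖ = 1) {c : ℝ} (hc : ‖η‖ < c) :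
    ‖(‖c • n + η‖)⁻¹ • (c • n + η) - n‖ ≤ 2 * ‖η‖ / (c - ‖η‖) := by
  set v := c • n + η with hv
  have hc0 : 0 < c := (norm_nonneg η).trans_lt hc
  have hcn : ‖c • n‖ = c := by rw [norm_smul, hn, mul_one, Real.norm_of_nonneg hc0.le]
  have hvlow : c - ‖η‖ ≤ ‖v‖ := by
    have := norm_sub_norm_le (c • n) (-η)
    rw [norm_neg, hcn, sub_neg_eq_add] at this
    linarith [abs_sub_abs_le_abs_sub ‖c • n‖ ‖η‖, norm_sub_le (c • n + η) η,
      show ‖c • n + η - η‖ = c by rw [add_sub_cancel_right, hcn]]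
  have hvup : ‖v‖ ≤ c + ‖η‖ := (norm_add_le _ _).trans (by rw [hcn])
  have hvpos : 0 < ‖v‖ := lt_of_lt_of_le (by linarith) hvlow
  have hkey : (‖v‖)⁻¹ • v - n = (‖v‖)⁻¹ • (v - ‖v‖ • n) := by
    rw [smul_sub, smul_smul, inv_mul_cancel₀ hvpos.ne', one_smul]
  have hdiff : v - ‖v‖ • n = (c - ‖v‖) • n + η := by
    rw [hv, sub_smul]; abel
  rw [hkey, norm_smul, norm_inv, norm_norm, hdiff]
  calc ‖v‖⁻¹ * ‖(c - ‖v‖) • n + η‖ ≤ ‖v‖⁻¹ * (2 * ‖η‖) := by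
        refine mul_le_mul_of_nonneg_left ?_ (inv_nonneg.2 (norm_nonneg _))
        calc ‖(c - ‖v‖) • n + η‖ ≤ ‖(c - ‖v‖) • n‖ + ‖η‖ := norm_add_le _ _
          _ = |c - ‖v‖| + ‖η‖ := by rw [norm_smul, hn, mul_one, Real.norm_eq_abs]
          _ ≤ 2 * ‖η‖ := by
              have : |c - ‖v‖| ≤ ‖η‖ := abs_sub_le_iff.2 ⟨by linarith, by linarith⟩
              linarith
    _ = 2 * ‖η‖ / ‖v‖ := by rw [inv_mul_eq_div]
    _ ≤ 2 * ‖η‖ / (c - ‖η‖) := by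
        exact div_le_div_of_nonneg_left (by positivity) (by linarith) hvlow

set_option maxHeartbeats 800000 in
/-- **Geometry of one transfer.**  The target sits at relative position `a = s e + Δ` (`‖Δ‖ ≤ δ`),
the relative velocity `U` points within `α` of the axis `e`, the gap `s - ε` is positive and the
perturbations are small (`s α + δ ≤ (s - ε)/4`, `s ≤ 2 ε`).  Then the flight line passes at distance
`p ≤ s α + δ < ε`, the target is ahead, the hit time is `(s - ε ± (δ + p²/ε))/‖U‖`, and the contact
normal `n` is a unit vector with `⟪U, n⟫ ≥ ‖U‖ (1 - p²/ε²)` whose deviation from the axis CONTRACTS: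
`‖n - e‖ ≤ ((s - ε) α + 2 δ + p²/ε)/ε`. [folklore] -/
theorem transfer_geometry {e Δ U : E} (he : ‖e‖ = 1) (hU : U ≠ 0) {s ε α δ : ℝ} (hε : 0 < ε)
    (hεs : ε < s) (hs2 : s ≤ 2 * ε) (hα0 : 0 ≤ α) (hα : ‖(‖U‖)⁻¹ • U - e‖ ≤ α) (hδ : ‖Δ‖ ≤ δ)
    (hsmall : s * α + δ ≤ (s - ε) / 4) :
    ‖perpC (s • e + Δ) U‖ ≤ s * α + δ ∧
    ε < parC (s • e + Δ) U ∧ ‖perpC (s • e + Δ) U‖ < ε ∧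
    (s - ε - (δ + ‖perpC (s • e + Δ) U‖ ^ 2 / ε)) / ‖U‖ ≤ hitTime (s • e + Δ) U ε ∧
    hitTime (s • e + Δ) U ε ≤ (s - ε + (δ + ‖perpC (s • e + Δ) U‖ ^ 2 / ε)) / ‖U‖ ∧
    ‖ε⁻¹ • (s • e + Δ - hitTime (s • e + Δ) U ε • U)‖ = 1 ∧
    ‖ε⁻¹ • (s • e + Δ - hitTime (s • e + Δ) U ε • U) - e‖ ≤
      ((s - ε) * α + 2 * δ + ‖perpC (s • e + Δ) U‖ ^ 2 / ε) / ε ∧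
    ‖U‖ * (1 - ‖perpC (s • e + Δ) U‖ ^ 2 / ε ^ 2) ≤
      ⟪U, ε⁻¹ • (s • e + Δ - hitTime (s • e + Δ) U ε • U)⟫_ℝ ∧
    ⟪U, ε⁻¹ • (s • e + Δ - hitTime (s • e + Δ) U ε • U)⟫_ℝ ≤ ‖U‖ := by
  set a := s • e + Δ with ha
  set p := ‖perpC a U‖ with hp
  have hn : 0 < ‖U‖ := norm_pos_iff.2 hU
  have hs0 : 0 < s := hε.trans hεs
  have hδ0 : 0 ≤ δ := (norm_nonneg Δ).trans hδ
  have hg0 : 0 < s - ε := sub_pos.2 hεs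
  have hse : ‖s • e‖ = s := by rw [norm_smul, he, mul_one, Real.norm_of_nonneg hs0.le]
  -- the flight line passes close to the target centre
  have hpbound : p ≤ s * α + δ := by
    have h1 := norm_perpC_le hU a (s / ‖U‖)
    have h2 : a - (s / ‖U‖) • U = s • (e - (‖U‖)⁻¹ • U) + Δ := by
      rw [ha, div_eq_mul_inv, ← smul_smul, smul_sub]; abel
    rw [h2] at h1
    calc p ≤ ‖s • (e - (‖U‖)⁻¹ • U) + Δ‖ := h1
      _ ≤ ‖s • (e - (‖U‖)⁻¹ • U)‖ + ‖Δ‖ := norm_add_le _ _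
      _ ≤ s * α + δ := by
          rw [norm_smul, Real.norm_of_nonneg hs0.le, norm_sub_rev]
          exact add_le_add (mul_le_mul_of_nonneg_left hα hs0.le) hδ
  have hp0 : 0 ≤ p := norm_nonneg _
  have hpg : p ≤ (s - ε) / 4 := hpbound.trans hsmall
  have hδg : δ ≤ (s - ε) / 4 := by nlinarith
  have hpε : p < ε := by linarith
  -- norm of `a`
  have ha_low : s - δ ≤ ‖a‖ := by
    have := norm_sub_norm_le (s • e) (-Δ)
    rw [hse, norm_neg, sub_neg_eq_add] at this
    linarith
  have ha_up : ‖a‖ ≤ s + δ := by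
    calc ‖a‖ ≤ ‖s • e‖ + ‖Δ‖ := norm_add_le _ _
      _ ≤ s + δ := by rw [hse]; linarith
  have ha_pos : ε < ‖a‖ := by linarith
  have ha0 : a ≠ 0 := by
    intro h; rw [h, norm_zero] at ha_pos; linarith
  -- the target is ahead
  have hpar_up : parC a U ≤ s + δ := (parC_le_norm hU a).trans ha_up
  have hp2 : p ^ 2 / ‖a‖ ≤ p ^ 2 / ε :=
    div_le_div_of_nonneg_left (sq_nonneg p) hε ha_pos.le
  have hpar_low : s - δ - p ^ 2 / ε ≤ parC a U := by
    -- first show `parC ≥ 0`, then use the second-order defect bound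
    have hsq := norm_sq_eq_parC_sq_add hU a
    have hpar_abs : ‖a‖ ^ 2 - p ^ 2 ≤ parC a U ^ 2 := by rw [hp] ; linarith
    have hpar_nonneg : 0 ≤ parC a U := by
      -- `parC = ⟪a, U⟫/‖U‖` and `⟪a,U⟫ = s ⟪e,U⟫ + ⟪Δ,U⟫ ≥ s ‖U‖ (1 - α²/2) - δ‖U‖ > 0`
      have hÛ : ‖(‖U‖)⁻¹ • U‖ = 1 := by
        rw [norm_smul, norm_inv, norm_norm, inv_mul_cancel₀ hn.ne']
      have hinner_e : 1 - α ^ 2 / 2 ≤ ⟪e, (‖U‖)⁻¹ • U⟫_ℝ := by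
        have h := norm_sub_sq_real ((‖U‖)⁻¹ • U) e
        rw [hÛ, he, real_inner_comm] at h
        have hle : ‖(‖U‖)⁻¹ • U - e‖ ^ 2 ≤ α ^ 2 := pow_le_pow_left₀ (norm_nonneg _) hα 2
        nlinarith
      have h1 : ⟪a, U⟫_ℝ = ‖U‖ * (s * ⟪e, (‖U‖)⁻¹ • U⟫_ℝ + ⟪Δ, (‖U‖)⁻¹ • U⟫_ℝ) := by
        rw [ha, inner_add_left, real_inner_smul_left, real_inner_smul_right, real_inner_smul_right]
        field_simp
      have h2 : |⟪Δ, (‖U‖)⁻¹ • U⟫_ℝ| ≤ δ := by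
        calc |⟪Δ, (‖U‖)⁻¹ • U⟫_ℝ| ≤ ‖Δ‖ * ‖(‖U‖)⁻¹ • U‖ := abs_real_inner_le_norm _ _
          _ ≤ δ := by rw [hÛ, mul_one]; exact hδ
      have hα1 : α ≤ 1 := by nlinarith
      have h3 : 0 ≤ s * ⟪e, (‖U‖)⁻¹ • U⟫_ℝ + ⟪Δ, (‖U‖)⁻¹ • U⟫_ℝ := by
        have := abs_le.1 h2
        nlinarith
      unfold parC
      rw [h1]
      exact div_nonneg (mul_nonneg hn.le h3) hn.le
    have := norm_sub_parC_le hU ha0 hpar_nonneg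
    linarith
  have hpar_gt : ε < parC a U := by
    have : p ^ 2 / ε ≤ (s - ε) / 4 := by
      rw [div_le_iff₀ hε]
      have hg1 : s - ε ≤ ε := by linarith
      nlinarith
    linarith
  obtain ⟨hθpos, hcontact, -, hθlow, hθup⟩ := hitTime_spec hU hε hpε hpar_gt
  obtain ⟨hdec, hinner, hinner_low⟩ := hitNormal_spec hU hε hpε
  set θ := hitTime a U ε with hθ
  set q := Real.sqrt (ε ^ 2 - p ^ 2) with hq
  have hq_le : q ≤ ε := by
    have hqsq : q ^ 2 = ε ^ 2 - p ^ 2 := Real.sq_sqrt (by nlinarith)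
    nlinarith [Real.sqrt_nonneg (ε ^ 2 - p ^ 2), sq_nonneg p]
  have hq_ge : ε - p ^ 2 / ε ≤ q := sub_sq_div_le_sqrt hε hp0 hpε
  refine ⟨hpbound, hpar_gt, hpε, ?_, ?_, ?_, ?_, ?_, ?_⟩
  · refine le_trans ?_ hθlow
    exact div_le_div_of_nonneg_right (by linarith) hn.le
  · refine hθup.trans ?_
    exact div_le_div_of_nonneg_right (by linarith) hn.le
  · rw [norm_smul, norm_inv, Real.norm_of_nonneg hε.le, hcontact, inv_mul_cancel₀ hε.ne']
  · -- contraction of the direction error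
    have hθU : θ * ‖U‖ = parC a U - q := by
      rw [hθ, hitTime, ← hp, ← hq, div_mul_cancel₀ _ hn.ne']
    have hkey : ε⁻¹ • (a - θ • U) - e =
        ε⁻¹ • ((s - ε) • (e - (‖U‖)⁻¹ • U) + (s - ε - θ * ‖U‖) • ((‖U‖)⁻¹ • U) + Δ) := by
      have hεe : ε⁻¹ • (a - θ • U) - e = ε⁻¹ • (a - θ • U - ε • e) := by
        rw [smul_sub ε⁻¹ (a - θ • U) (ε • e), smul_smul, inv_mul_cancel₀ hε.ne', one_smul]
      rw [hεe]
      congr 1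
      have hθU' : θ • U = (θ * ‖U‖) • ((‖U‖)⁻¹ • U) := by
        rw [smul_smul, mul_assoc, mul_inv_cancel₀ hn.ne', mul_one]
      rw [hθU', ha]
      module
    have hmid : |s - ε - θ * ‖U‖| ≤ δ + p ^ 2 / ε := by
      rw [hθU, abs_le]
      have h1 := norm_sub_parC_le hU ha0 (by linarith : 0 ≤ parC a U)
      have h2 := parC_le_norm hU a
      constructor <;> nlinarith
    have hÛ : ‖(‖U‖)⁻¹ • U‖ = 1 := by
      rw [norm_smul, norm_inv, norm_norm, inv_mul_cancel₀ hn.ne']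
    rw [hkey, norm_smul, norm_inv, Real.norm_of_nonneg hε.le, inv_mul_eq_div]
    refine div_le_div_of_nonneg_right ?_ hε.le
    calc ‖(s - ε) • (e - (‖U‖)⁻¹ • U) + (s - ε - θ * ‖U‖) • ((‖U‖)⁻¹ • U) + Δ‖
        ≤ ‖(s - ε) • (e - (‖U‖)⁻¹ • U)‖ + ‖(s - ε - θ * ‖U‖) • ((‖U‖)⁻¹ • U)‖ + ‖Δ‖ :=
          norm_add₃_le
      _ ≤ (s - ε) * α + (δ + p ^ 2 / ε) + δ := by
          refine add_le_add (add_le_add ?_ ?_) hδ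
          · rw [norm_smul, Real.norm_of_nonneg hg0.le, norm_sub_rev]
            exact mul_le_mul_of_nonneg_left hα hg0.le
          · rw [norm_smul, hÛ, mul_one, Real.norm_eq_abs]
            exact hmid
      _ = (s - ε) * α + 2 * δ + p ^ 2 / ε := by ring
  · rw [real_inner_smul_right]
    have : ‖U‖ * (1 - p ^ 2 / ε ^ 2) = ε⁻¹ * (‖U‖ * (ε - p ^ 2 / ε)) := by
      field_simp
    rw [this]
    exact mul_le_mul_of_nonneg_left hinner_low (inv_nonneg.2 hε.le)
  · rw [real_inner_smul_right, hinner]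
    calc ε⁻¹ * (‖U‖ * q) ≤ ε⁻¹ * (‖U‖ * ε) := by
          refine mul_le_mul_of_nonneg_left (mul_le_mul_of_nonneg_left hq_le hn.le) ?_
          exact inv_nonneg.2 hε.le
      _ = ‖U‖ := by field_simp

/-- **Kinematics of one transfer** (equal masses, contact normal `n`, `⟪U, n⟫ = c > ‖η‖` where
`U = W - η` is the relative velocity of the carrier `W` w.r.t. the target `η`): the target leaves
with `W' = η + c n`, the carrier keeps `ρ = W - c n`; impulses are `c`, the new speed is `c ± ‖η‖`,
the new direction is within `2‖η‖/(c - ‖η‖)` of `n`, the energy received is `c² + 2c⟪η, n⟫`, and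
the residual speed is at most `‖U - c n‖ + ‖η‖` with `‖U - c n‖² = ‖U‖² - c²`. [folklore] -/
theorem transfer_kinematics {n U η : E} (hn : ‖n‖ = 1) {c : ℝ} (hc : ⟪U, n⟫_ℝ = c)
    (hcη : ‖η‖ < c) :
    ‖(η + c • n) - η‖ = c ∧ ‖(U + η - c • n) - (U + η)‖ = c ∧
    c - ‖η‖ ≤ ‖η + c • n‖ ∧ ‖η + c • n‖ ≤ c + ‖η‖ ∧
    ‖(‖η + c • n‖)⁻¹ • (η + c • n) - n‖ ≤ 2 * ‖η‖ / (c - ‖η‖) ∧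
    ‖η + c • n‖ ^ 2 - ‖η‖ ^ 2 = c ^ 2 + 2 * c * ⟪η, n⟫_ℝ ∧
    ‖U + η - c • n‖ ≤ ‖U - c • n‖ + ‖η‖ ∧
    ‖U - c • n‖ ^ 2 = ‖U‖ ^ 2 - c ^ 2 := by
  have hc0 : 0 < c := (norm_nonneg η).trans_lt hcη
  have hcn : ‖c • n‖ = c := by rw [norm_smul, hn, mul_one, Real.norm_of_nonneg hc0.le]
  refine ⟨?_, ?_, ?_, ?_, ?_, ?_, ?_, ?_⟩
  · rw [add_sub_cancel_left, hcn]
  · rw [sub_sub_cancel_left, norm_neg, hcn]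
  · have := norm_sub_norm_le (c • n) (-η)
    rw [hcn, norm_neg, sub_neg_eq_add, add_comm] at this
    linarith [abs_le.1 (abs_norm_sub_norm_le (c • n) (-η))]
  · calc ‖η + c • n‖ ≤ ‖η‖ + ‖c • n‖ := norm_add_le _ _
      _ = c + ‖η‖ := by rw [hcn, add_comm]
  · have := norm_normalize_sub_le (η := η) hn hcη
    rwa [add_comm] at this
  · rw [norm_add_sq_real, real_inner_smul_right, hcn]
    ring
  · calc ‖U + η - c • n‖ = ‖(U - c • n) + η‖ := by abel_nf
      _ ≤ ‖U - c • n‖ + ‖η‖ := norm_add_le _ _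
  · rw [norm_sub_sq_real, real_inner_smul_right, hc, hcn]
    ring

/-- The residual (tangential) relative velocity after a nearly head-on transfer is small:
`‖U - c n‖ ≤ 2 ‖U‖ p/ε` when `c = ⟪U, n⟫ ≥ ‖U‖ (1 - p²/ε²)` and `p ≤ ε`. [folklore] -/
theorem norm_sub_inner_smul_le {n U : E} (hn : ‖n‖ = 1) {p ε : ℝ} (hε : 0 < ε) (hp0 : 0 ≤ p)
    (hp : p ≤ ε) (hlow : ‖U‖ * (1 - p ^ 2 / ε ^ 2) ≤ ⟪U, n⟫_ℝ) :
    ‖U - ⟪U, n⟫_ℝ • n‖ ≤ 2 * ‖U‖ * p / ε := by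
  set c := ⟪U, n⟫_ℝ with hc
  have hsq : ‖U - c • n‖ ^ 2 = ‖U‖ ^ 2 - c ^ 2 := by
    rw [norm_sub_sq_real, real_inner_smul_right, ← hc, norm_smul, hn, mul_one, Real.norm_eq_abs,
      sq_abs]
    ring
  have hx : 0 ≤ p ^ 2 / ε ^ 2 ∧ p ^ 2 / ε ^ 2 ≤ 1 := by
    constructor
    · positivity
    · rw [div_le_one (by positivity)]
      exact pow_le_pow_left₀ hp0 hp 2
  have hU0 : 0 ≤ ‖U‖ := norm_nonneg _
  have hc_le : c ≤ ‖U‖ := by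
    calc c ≤ ‖U‖ * ‖n‖ := real_inner_le_norm _ _
      _ = ‖U‖ := by rw [hn, mul_one]
  have hcl : ‖U‖ * (1 - p ^ 2 / ε ^ 2) ≤ c := hlow
  have hc_nonneg : 0 ≤ ‖U‖ * (1 - p ^ 2 / ε ^ 2) := mul_nonneg hU0 (by linarith [hx.2])
  -- `‖U‖² - c² ≤ ‖U‖² (1 - (1 - x)²) ≤ 2 x ‖U‖² ≤ (2 ‖U‖ p/ε)²`
  have hbound : ‖U - c • n‖ ^ 2 ≤ (2 * ‖U‖ * p / ε) ^ 2 := by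
    rw [hsq]
    have h1 : (‖U‖ * (1 - p ^ 2 / ε ^ 2)) ^ 2 ≤ c ^ 2 := pow_le_pow_left₀ hc_nonneg hcl 2
    have h2 : (2 * ‖U‖ * p / ε) ^ 2 = ‖U‖ ^ 2 * (4 * (p ^ 2 / ε ^ 2)) := by
      field_simp
      ring
    rw [h2]
    nlinarith [hx.1, hx.2, sq_nonneg ‖U‖]
  have hr : 0 ≤ 2 * ‖U‖ * p / ε := by positivity
  nlinarith [norm_nonneg (U - c • n), hbound, sq_nonneg (‖U - c • n‖ - 2 * ‖U‖ * p / ε)]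

end Transfer

end EquilibriumClampedCollisionalWindowLDNegative

end Summit.AtomisticToContinuum.HydrodynamicLimit.Theorems

end
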